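import Summits.Ventures.LatticeQCDFlow.Scaling.HaarStartProtocolLawShift
import HarnessLib

/-!
# THEORY-2 item 129 — the `log²` LAYER LAW FROM THE HAAR PRIOR: an all-coupling Wilson variance
floor `Var_{π_u}(S_W) ≥ c·#plaq/(1+u²)` (`u ≥ 0`, `c = c(n,d) > 0` uniform in the volume) and
the layer / window laws for EVERY monotone protocol `0 ≤ b_0 ≤ … ≤ b_m`, including the start
`b_0 = 0`
PART 2 of 2 (§3 the all-coupling Wilson floor, §4 the Wilson laws from any start).  CUSTODY: theory2 item 129 (GEN-42, HOME tier) re-landed by lean-2 GEN-10 per LEAD LINE 257 RT-30 (210)(d)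
(the packet's FIFTH member after 125 → 126 → 127 → 128); statements and proofs =
HOME/lean/theory2/HaarStartProtocolLaw.lean 6e9239f81cd059d4 (504 l) verbatim, split below the `lint.size`
line into TWO files (`HaarStartProtocolLawShift` §1–§2, `HaarStartProtocolLaw` §3–§4, the second importing
the first); headers trimmed (PART 2 keeps the full HOME header); imports = HOME's (all tree modules:
items 125 / 126 / 128 as landed); landing edits: one docstring added where the lint asks
(`card_plaquette_pos`), and — named by the gate's `near-duplicate` screen at dry-run — HOME's two elementary
lemmas `one_add_sq_le_sq_one_add` (`1 + u² ≤ (1+u)²`, ≡ `Literature.NumberTheory.Sieve.RegimeB.one_add_sq_le_sq`)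
and `sq_one_add_le_two_mul` (unused) DROPPED, the single use in `floor_shift_of_floor` inlined as
`by nlinarith [hu]`; no other declaration changes (builder `build129.py` in the custodian's seat folder).

HONEST FRAMING: exact (Metropolis-corrected) sampling algorithms for lattice gauge theory;
figures of merit are autocorrelation/cost numbers at stated couplings and volumes; no
continuum-physics claim.

OURS (pub-lqcd THEORY-2, gen-42; HOME tier, LEAD LINE 194 (B): it SHARPENS items 125 + 126 + 128,
no new calculus, 0 kit).  What item 125/128 left open.  Item 125's `log² R` law
`c·#plaq·log²(b_m/b_0)/(m + log(b_m/b_0)) ≤ Σ_j log E_{μ_{b_j}}[w_j²]` (now unconditional by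
item 128) needs a START `b_0 ≥ β₀ > 0` and its constant carries `β₀` (`c = c(n,d,β₀)`, a factor
`e^{−16n(d−1)β₀}`); the ratio `R = b_m/b_0` is infinite for the protocols that matter most for
flow-based / annealed samplers, which start AT THE HAAR PRIOR `b_0 = 0` (normalizing flows from
the Haar measure, SNF / CRAFT / AIS / Jarzynski ladders `0 = b_0 < b_1 < … < b_m = β`).

THIS FILE.
* §1 (abstract, one line of algebra): the protocol cost is SHIFT-INVARIANT,
  `protocolCost (F(· − a)) (a + b) = protocolCost F b` (`protocolCost_shift`), and a
  second-derivative floor `K/(1+u)² ≤ ψ″(u)` on `[0, ∞)` is convexity of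
  `v ↦ ψ(v − 1) + K log v` on `[1, ∞)` (`convexOn_shift_add_mul_log_of_floor`, from item 125's
  `convexOn_add_mul_log_of_floor` at `β₀ = 1`).
  Hence item 125's three laws hold VERBATIM with `log(b_m/b_0)` replaced by
  **`log((1 + b_m)/(1 + b_0))`** for every monotone protocol with `b_0 ≥ 0`
  (`protocolCost_ge_sq_div_shift`, `layers_necessary_shift`, `logRatio_le_of_stepCost_shift`).
* §2 (lattice, smooth action `S` on `SU(N)^E`): under the ALL-COUPLING FLOOR
  `∀ u ≥ 0, K/(1+u²) ≤ Var_u(S)` (which implies `K/(1+u)²` since `(1+u)² ≥ 1+u²`, and implies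
  item 125's (SH) on `[β₀,∞)` with `K·β₀²/(1+β₀²)`, `specificHeatFloor_of_allCouplingFloor`):
  **`K·log²((1+b_m)/(1+b_0))/(m + log((1+b_m)/(1+b_0))) ≤ Σ_j log E_{μ_{b_j}}[w_j²]`**
  (`protocolLaw_of_allCouplingFloor`), layers `m ≥ K·log²(…)/t − log(…)`
  (`layers_necessary_of_allCouplingFloor`), windows `log((1+b_m)/(1+b_0)) ≤ m(t₀/K + √(t₀/K))`
  (`logRatio_le_of_stepCost_of_allCouplingFloor`).
* §3 (Wilson, `SU(n)`, `n ≥ 2`, `d ≥ 2`): **`wilson_variance_floor_allCouplings`**: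
  `∃ c = c(n,d) > 0, ∀ L ≥ 2, ∀ u ≥ 0, c·#plaq(d,L)/(1+u²) ≤ Var_{π_u}(S_W)` — item 128's
  `wilsonSpecificHeatFloorUniform` at `β₀ = 1` for `u ≥ 1` (`u² ≤ 1+u²`) glued to item 126's
  window floor `L⌊L/2⌋^{d−1}e^{−8n(d−1)}V_H ≥ c₂·#plaq` for `0 ≤ u ≤ 1` (`#plaq ≤ d²L^d`,
  `L^d ≤ 3^{d−1}·L⌊L/2⌋^{d−1}`, `V_H = Var_Haar(Re tr) > 0`); `c = min(c₁, c₂)` depends on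
  `(n, d)` ONLY — no `β₀`.
* §4 (Wilson laws from ANY start `b_0 ≥ 0`, unconditional, one `c` for all volumes):
  **`wilson_protocolLaw_anyStart`**, **`wilson_layers_necessary_anyStart`**,
  **`wilson_logRatio_le_of_stepCost_anyStart`**, and the HAAR-START forms (`b_0 = 0`, `b_m = β`):
  **`m ≥ c·#plaq·log²(1+β)/t − log(1+β)`** (`wilson_layers_necessary_haarStart`) and
  **`log(1+β) ≤ m·(t₀/(c·#plaq) + √(t₀/(c·#plaq)))`**
  (`wilson_logRatio_le_of_stepCost_haarStart`): an exact annealing / reweighting ladder from the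
  Haar measure to coupling `β` whose every step has an `O(1)` weight-variance window needs at
  least `½√(c·#plaq/t₀)·log(1+β)` steps, in EVERY volume.

WHAT IT DOES NOT SAY.  `c` is an existence constant (item 128's compactness constant at `β₀ = 1`
and `e^{−8n(d−1)}V_H/(d²3^{d−1})`): no number, nothing specific at `β ≈ 6`, nothing about
autocorrelations of a given algorithm, nothing about fermions; the laws bound sequential EXACT
reweighting / perfectly-relaxed annealing protocols in the coupling (the quantity
`Σ_j log E_{μ_{b_j}}[w_j²]`), not the training cost of a particular network.  The shift `a = 1`
is the optimal member of the one-parameter family `a > 0` (`(a+u)² ≥ min(a²,1)(1+u²)`): nothing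
is lost by fixing it.

Dictionary (tree): `weightSqMoment`, `actionCGF`, `actionVar`, `protocolCost`,
`sum_log_weightSqMoment_eq_protocolCost`, `protocolCost_ge_sq_div`, `layers_necessary`,
`logRatio_le_of_stepCost`, `convexOn_add_mul_log_of_floor` (item 125);
`wilson_variance_ge_extensive_window` (item 126); `wilsonSpecificHeatFloorUniform`,
`variance_amb_eq`, `haarVar_pos`, `pow_succ_le_three_pow_mul` (item 128);
`hasDerivAt_cgf_neg_action`, `hasDerivAt_deriv_cgf`, `contDiff_ambWilsonAction` (T25
`ReweightingStepLaw` / Lüscher 2010 tree).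
The three imports `Summits.Ventures.LatticeQCDFlow.Scaling.{SpecificHeatFloorLog2Law, ExtensiveSpecificHeat,
WilsonSpecificHeatFloor}` are the TREE modules of items 125 (PART 2), 126 (PART 4) and 128 (PART 4) as
landed by lean-2 GEN-9 / GEN-10 (no placeholder left); theory2's HOME certificate was the concatenation
`HOME/lean/theory2/check/HaarStartProtocolLaw_concat.lean` = items 125 ‖ 126 ‖ 127 ‖ 128 ‖ 129 (farm
`lean check` rc 0 · 0 sorry · axioms standard); the custodian re-checked both parts standalone against
the tree before landing.
-/

noncomputable section

open Finset Set Real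

namespace Summit.Ventures.LatticeQCDFlow.Theory2.HaarStart

open Summit.Ventures.LatticeQCDFlow.Theory2.SpecificHeat

/-! ## §3. The Wilson action: the all-coupling variance floor, uniform in the volume -/

section Wilson

open MeasureTheory ProbabilityTheory
open Literature.MathematicalPhysics.QuantumFieldTheory
open Literature.MathematicalPhysics.QuantumFieldTheory.Luscher2010
open Literature.MathematicalPhysics.QuantumFieldTheory.WilsonFlow (coeConfig)
open Summit.Ventures.LatticeQCDFlow.TrivializingMaps
open Summit.Ventures.LatticeQCDFlow.Theory2.WilsonSpecificHeat
open scoped ContDiff Matrix Matrix.Norms.Frobenius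

variable {d L n : ℕ}

/-- **Strong-coupling window, volume-uniform per-plaquette form** (item 126 at `B = 1` + counting):
on `(ℤ/L)^{d+2}`, `L ≥ 2`, for `|u| ≤ 1`,
`e^{−8n(d+1)}·V_H/((d+2)²·3^{d+1}) · #plaq ≤ Var_{π_u}(S_W)`. [ours] -/
theorem wilson_variance_floor_window [NeZero L] (hL : 2 ≤ L) {u : ℝ} (hu : |u| ≤ 1) :
    Real.exp (-(8 * n * (d + 1) * 1)) *
          variance (fun g : ↥(Matrix.specialUnitaryGroup (Fin n) ℂ) =>
            ((StrongCoupling.defRep n) g).trace.re)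
            (haarProbability ↥(Matrix.specialUnitaryGroup (Fin n) ℂ)) /
          (((d : ℝ) + 2) ^ 2 * 3 ^ (d + 1)) * Fintype.card (Plaquette (d + 2) L) ≤
      variance (fun U => ambWilsonAction (coeConfig U))
        (boltzmannMeasure fun U : GaugeConfig (d + 2) L (Matrix.specialUnitaryGroup (Fin n) ℂ) =>
          u * ambWilsonAction (coeConfig U)) := by
  haveI : SecondCountableTopology (Matrix (Fin n) (Fin n) ℂ) :=
    inferInstanceAs (SecondCountableTopology (Fin n → Fin n → ℂ))
  haveI : SecondCountableTopology ↥(Matrix.specialUnitaryGroup (Fin n) ℂ) :=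
    Topology.IsEmbedding.subtypeVal.secondCountableTopology
  rw [variance_amb_eq u]
  refine le_trans ?_ (Theory2.ExtensiveSpecificHeat.wilson_variance_ge_extensive_window
    (StrongCoupling.defRep n) hL continuous_subtype_val hu)
  have hv : 0 ≤ variance (fun g : ↥(Matrix.specialUnitaryGroup (Fin n) ℂ) =>
      ((StrongCoupling.defRep n) g).trace.re)
      (haarProbability ↥(Matrix.specialUnitaryGroup (Fin n) ℂ)) := variance_nonneg _ _
  have hplaq :
      (Fintype.card (Plaquette (d + 2) L) : ℝ) ≤ ((d : ℝ) + 2) ^ 2 * (L : ℝ) ^ (d + 2) := by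
    exact_mod_cast LatticeForm.card_plaquette_le (d := d + 2) (L := L)
  have hL3 : (L : ℝ) ^ (d + 2) ≤ 3 ^ (d + 1) * ((L * (L / 2) ^ (d + 1) : ℕ) : ℝ) :=
    pow_succ_le_three_pow_mul hL (d + 1)
  have h32 : (0 : ℝ) < ((d : ℝ) + 2) ^ 2 * 3 ^ (d + 1) := by positivity
  have hD : ((d : ℝ) + 2) ^ 2 * 3 ^ (d + 1) ≠ 0 := h32.ne'
  have hA : 0 ≤ Real.exp (-(8 * n * (d + 1) * 1)) *
      variance (fun g : ↥(Matrix.specialUnitaryGroup (Fin n) ℂ) =>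
        ((StrongCoupling.defRep n) g).trace.re)
        (haarProbability ↥(Matrix.specialUnitaryGroup (Fin n) ℂ)) /
      (((d : ℝ) + 2) ^ 2 * 3 ^ (d + 1)) := div_nonneg (mul_nonneg (Real.exp_pos _).le hv) h32.le
  have hPX : (Fintype.card (Plaquette (d + 2) L) : ℝ) ≤
      ((d : ℝ) + 2) ^ 2 * (3 ^ (d + 1) * ((L * (L / 2) ^ (d + 1) : ℕ) : ℝ)) :=
    hplaq.trans (mul_le_mul_of_nonneg_left hL3 (by positivity))
  calc Real.exp (-(8 * n * (d + 1) * 1)) *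
          variance (fun g : ↥(Matrix.specialUnitaryGroup (Fin n) ℂ) =>
            ((StrongCoupling.defRep n) g).trace.re)
            (haarProbability ↥(Matrix.specialUnitaryGroup (Fin n) ℂ)) /
          (((d : ℝ) + 2) ^ 2 * 3 ^ (d + 1)) * Fintype.card (Plaquette (d + 2) L)
      ≤ Real.exp (-(8 * n * (d + 1) * 1)) *
          variance (fun g : ↥(Matrix.specialUnitaryGroup (Fin n) ℂ) =>
            ((StrongCoupling.defRep n) g).trace.re)
            (haarProbability ↥(Matrix.specialUnitaryGroup (Fin n) ℂ)) /
          (((d : ℝ) + 2) ^ 2 * 3 ^ (d + 1)) *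
          (((d : ℝ) + 2) ^ 2 * (3 ^ (d + 1) * ((L * (L / 2) ^ (d + 1) : ℕ) : ℝ))) :=
        mul_le_mul_of_nonneg_left hPX hA
    _ = ((L * (L / 2) ^ (d + 1) : ℕ) : ℝ) * Real.exp (-(8 * n * (d + 1) * 1)) *
          variance (fun g : ↥(Matrix.specialUnitaryGroup (Fin n) ℂ) =>
            ((StrongCoupling.defRep n) g).trace.re)
            (haarProbability ↥(Matrix.specialUnitaryGroup (Fin n) ℂ)) := by
        rw [div_mul_eq_mul_div, div_eq_iff hD]
        ring

/-- **THEOREM (item 129). The all-coupling Wilson variance floor, uniform in the volume.**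
For `n ≥ 2`, `d ≥ 2` there is `c = c(d, n) > 0` such that for every `L ≥ 2` and EVERY
`u ≥ 0`,
**`Var_{π_u}(S_W) ≥ c · #plaquettes(d, L) / (1 + u²)`**
(item 128 on `[1, ∞)` glued to item 126's window floor on `[0, 1]`). [ours] -/
theorem wilson_variance_floor_allCouplings (hn : 2 ≤ n) (hd : 2 ≤ d) :
    ∃ c : ℝ, 0 < c ∧ ∀ (L : ℕ) [NeZero L], 2 ≤ L → ∀ u : ℝ, 0 ≤ u →
      c * Fintype.card (Plaquette d L) / (1 + u ^ 2) ≤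
        variance (fun U => ambWilsonAction (coeConfig U))
          (boltzmannMeasure fun U : GaugeConfig d L (Matrix.specialUnitaryGroup (Fin n) ℂ) =>
            u * ambWilsonAction (coeConfig U)) := by
  obtain ⟨d, rfl⟩ : ∃ d', d = d' + 2 := ⟨d - 2, by omega⟩
  obtain ⟨c₁, hc₁, h₁⟩ :=
    wilsonSpecificHeatFloorUniform (d := d + 2) hn (by omega) one_pos
  have hVH := haarVar_pos hn
  have h32 : (0 : ℝ) < ((d : ℝ) + 2) ^ 2 * 3 ^ (d + 1) := by positivity
  -- the strong-coupling window constant of `wilson_variance_floor_window`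
  set c₂ : ℝ := Real.exp (-(8 * n * (d + 1) * 1)) *
      variance (fun g : ↥(Matrix.specialUnitaryGroup (Fin n) ℂ) =>
        ((StrongCoupling.defRep n) g).trace.re)
        (haarProbability ↥(Matrix.specialUnitaryGroup (Fin n) ℂ)) /
      (((d : ℝ) + 2) ^ 2 * 3 ^ (d + 1)) with hc₂
  have hc₂pos : 0 < c₂ := div_pos (mul_pos (Real.exp_pos _) hVH) h32
  refine ⟨min c₁ c₂, lt_min hc₁ hc₂pos, fun L _ hL u hu => ?_⟩
  have hP : (0 : ℝ) ≤ Fintype.card (Plaquette (d + 2) L) := Nat.cast_nonneg _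
  have hu2 : (0 : ℝ) < 1 + u ^ 2 := by positivity
  rcases le_or_gt 1 u with h1u | hu1
  · -- `u ≥ 1`: item 128 at `β₀ = 1`, and `u² ≤ 1 + u²`
    refine le_trans ?_ (h₁ L hL u h1u)
    calc min c₁ c₂ * Fintype.card (Plaquette (d + 2) L) / (1 + u ^ 2)
        ≤ c₁ * Fintype.card (Plaquette (d + 2) L) / (1 + u ^ 2) :=
          div_le_div_of_nonneg_right (mul_le_mul_of_nonneg_right (min_le_left _ _) hP) hu2.le
      _ ≤ c₁ * Fintype.card (Plaquette (d + 2) L) / u ^ 2 :=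
          div_le_div_of_nonneg_left (mul_nonneg hc₁.le hP) (pow_pos (by linarith) 2) (by linarith)
  · -- `0 ≤ u < 1`: item 126's window floor in per-plaquette form, and `1 ≤ 1 + u²`
    have habs : |u| ≤ 1 := by rw [abs_of_nonneg hu]; exact hu1.le
    refine le_trans ?_ (wilson_variance_floor_window hL habs)
    calc min c₁ c₂ * Fintype.card (Plaquette (d + 2) L) / (1 + u ^ 2)
        ≤ c₂ * Fintype.card (Plaquette (d + 2) L) / (1 + u ^ 2) :=
          div_le_div_of_nonneg_right (mul_le_mul_of_nonneg_right (min_le_right _ _) hP) hu2.le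
      _ ≤ c₂ * Fintype.card (Plaquette (d + 2) L) :=
          div_le_self (mul_nonneg hc₂pos.le hP) (by nlinarith [sq_nonneg u])

/-- The all-coupling floor in item 125's vocabulary:
`∀ u ≥ 0, c·#plaq/(1+u²) ≤ actionVar S_W u`, one `c` for every volume. [ours] -/
theorem wilson_allCouplingFloor (hn : 2 ≤ n) (hd : 2 ≤ d) :
    ∃ c : ℝ, 0 < c ∧ ∀ (L : ℕ) [NeZero L], 2 ≤ L → ∀ u : ℝ, 0 ≤ u →
      c * Fintype.card (Plaquette d L) / (1 + u ^ 2) ≤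
        SpecificHeat.actionVar (ambWilsonAction : AmbConfig d L n → ℝ) u :=
  wilson_variance_floor_allCouplings hn hd

/-- **COROLLARY — item 125's (SH_W) for EVERY `β₀ > 0` with a `β₀`-TRANSPARENT constant**:
`WilsonSpecificHeatFloorUniform d n β₀ (c·β₀²/(1+β₀²))`, `c = c(n,d)` the all-coupling
constant. [ours] -/
theorem wilsonSpecificHeatFloorUniform_of_allCouplings (hn : 2 ≤ n) (hd : 2 ≤ d) :
    ∃ c : ℝ, 0 < c ∧ ∀ β₀ : ℝ, 0 < β₀ →
      SpecificHeat.WilsonSpecificHeatFloorUniform d n β₀ (c * β₀ ^ 2 / (1 + β₀ ^ 2)) := by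
  obtain ⟨c, hc, h⟩ := wilson_allCouplingFloor hn hd
  refine ⟨c, hc, fun β₀ hβ₀ L _ hL => ?_⟩
  have hK : 0 ≤ c * Fintype.card (Plaquette d L) := by positivity
  have h' := specificHeatFloor_of_allCouplingFloor hK hβ₀ (h L hL)
  rw [show c * Fintype.card (Plaquette d L) * β₀ ^ 2 / (1 + β₀ ^ 2) =
    c * β₀ ^ 2 / (1 + β₀ ^ 2) * Fintype.card (Plaquette d L) by ring] at h'
  exact h'

end Wilson

/-! ## §4. The Wilson layer / window laws from ANY start `b_0 ≥ 0` — in particular from the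
Haar prior `b_0 = 0` — unconditional, one constant for every volume -/

section WilsonLaws

open MeasureTheory ProbabilityTheory
open Literature.MathematicalPhysics.QuantumFieldTheory
open Literature.MathematicalPhysics.QuantumFieldTheory.Luscher2010
open Literature.MathematicalPhysics.QuantumFieldTheory.WilsonFlow (coeConfig)
open Summit.Ventures.LatticeQCDFlow.TrivializingMaps
open scoped ContDiff Matrix Matrix.Norms.Frobenius

variable {d n : ℕ}

/-- A torus of dimension `d ≥ 2` has at least one plaquette. [folklore] -/
theorem card_plaquette_pos (hd : 2 ≤ d) (L : ℕ) [NeZero L] :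
    0 < Fintype.card (Plaquette d L) := by
  obtain ⟨d', rfl⟩ : ∃ d', d = d' + 2 := ⟨d - 2, by omega⟩
  exact Fintype.card_pos_iff.2
    ⟨((0 : Site (d' + 2) L), ⟨((0 : Fin (d' + 2)), (1 : Fin (d' + 2))), Fin.zero_lt_one⟩)⟩

/-- **WILSON `log²` LAYER LAW FROM ANY START, UNCONDITIONAL.**  For `n ≥ 2`, `d ≥ 2` there is
`c = c(d, n) > 0` such that in EVERY volume `L ≥ 2`, every monotone protocol of exact reweighting
steps `0 ≤ b_0 ≤ … ≤ b_m` (`m ≥ 1`) obeys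
**`c·#plaq·log²((1+b_m)/(1+b_0))/(m + log((1+b_m)/(1+b_0))) ≤ Σ_j log E_{μ_{b_j}}[w_j²]`**.
[ours] -/
theorem wilson_protocolLaw_anyStart (hn : 2 ≤ n) (hd : 2 ≤ d) :
    ∃ c : ℝ, 0 < c ∧ ∀ (L : ℕ) [NeZero L], 2 ≤ L → ∀ (m : ℕ), 0 < m →
      ∀ b : Fin (m + 1) → ℝ, 0 ≤ b 0 → Monotone b →
        c * Fintype.card (Plaquette d L) * (Real.log ((1 + b (Fin.last m)) / (1 + b 0))) ^ 2 /
            (m + Real.log ((1 + b (Fin.last m)) / (1 + b 0))) ≤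
          ∑ j : Fin m, Real.log (weightSqMoment (ambWilsonAction : AmbConfig d L n → ℝ)
            (b j.castSucc) (b j.succ - b j.castSucc)) := by
  obtain ⟨c, hc, h⟩ := wilson_allCouplingFloor hn hd
  exact ⟨c, hc, fun L _ hL m hm b hb0 hb =>
    protocolLaw_of_allCouplingFloor contDiff_ambWilsonAction (by positivity) (h L hL) hm b hb0 hb⟩

/-- **WILSON LAYERS NECESSARY FROM ANY START, UNCONDITIONAL**: with the same `c`, in every volume
`L ≥ 2`, `Σ_j log E[w_j²] ≤ t` forces
**`m ≥ c·#plaq·log²((1+b_m)/(1+b_0))/t − log((1+b_m)/(1+b_0))`**. [ours] -/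
theorem wilson_layers_necessary_anyStart (hn : 2 ≤ n) (hd : 2 ≤ d) :
    ∃ c : ℝ, 0 < c ∧ ∀ (L : ℕ) [NeZero L], 2 ≤ L → ∀ (m : ℕ), 0 < m →
      ∀ b : Fin (m + 1) → ℝ, 0 ≤ b 0 → Monotone b → ∀ t : ℝ, 0 < t →
        (∑ j : Fin m, Real.log (weightSqMoment (ambWilsonAction : AmbConfig d L n → ℝ)
            (b j.castSucc) (b j.succ - b j.castSucc))) ≤ t →
          c * Fintype.card (Plaquette d L) * (Real.log ((1 + b (Fin.last m)) / (1 + b 0))) ^ 2 / t -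
              Real.log ((1 + b (Fin.last m)) / (1 + b 0)) ≤ m := by
  obtain ⟨c, hc, h⟩ := wilson_allCouplingFloor hn hd
  exact ⟨c, hc, fun L _ hL m hm b hb0 hb t ht hcost =>
    layers_necessary_of_allCouplingFloor contDiff_ambWilsonAction (by positivity) (h L hL) hm b hb0
      hb ht hcost⟩

/-- **WILSON PER-STEP WINDOW LAW FROM ANY START, UNCONDITIONAL**: with the same `c`, if every exact
reweighting step has `log E[w_j²] ≤ t₀` (`t₀ ≥ 0`) then
**`log((1+b_m)/(1+b_0)) ≤ m·(t₀/K + √(t₀/K))`**, `K = c·#plaq`. [ours] -/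
theorem wilson_logRatio_le_of_stepCost_anyStart (hn : 2 ≤ n) (hd : 2 ≤ d) :
    ∃ c : ℝ, 0 < c ∧ ∀ (L : ℕ) [NeZero L], 2 ≤ L →
      ∀ (m : ℕ) (b : Fin (m + 1) → ℝ),
      0 ≤ b 0 → Monotone b → ∀ t₀ : ℝ, 0 ≤ t₀ →
        (∀ j : Fin m, Real.log (weightSqMoment (ambWilsonAction : AmbConfig d L n → ℝ)
            (b j.castSucc) (b j.succ - b j.castSucc)) ≤ t₀) →
          Real.log ((1 + b (Fin.last m)) / (1 + b 0)) ≤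
            m * (t₀ / (c * Fintype.card (Plaquette d L)) +
              Real.sqrt (t₀ / (c * Fintype.card (Plaquette d L)))) := by
  obtain ⟨c, hc, h⟩ := wilson_allCouplingFloor hn hd
  refine ⟨c, hc, fun L _ hL m b hb0 hb t₀ ht hstep => ?_⟩
  have hK : 0 < c * Fintype.card (Plaquette d L) := by
    have := card_plaquette_pos hd L
    positivity
  exact logRatio_le_of_stepCost_of_allCouplingFloor contDiff_ambWilsonAction hK (h L hL) b hb0 hb ht
    hstep

/-- **HAAR START — LAYERS NECESSARY**: with the same `c`, every monotone protocol of exact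
reweighting steps FROM THE HAAR MEASURE `0 = b_0 ≤ b_1 ≤ … ≤ b_m = β` with `Σ_j log E[w_j²] ≤ t`
has **`m ≥ c·#plaq·log²(1+β)/t − log(1+β)`** layers — linear in the VOLUME times `log²(1+β)`,
in every volume `L ≥ 2`. [ours] -/
theorem wilson_layers_necessary_haarStart (hn : 2 ≤ n) (hd : 2 ≤ d) :
    ∃ c : ℝ, 0 < c ∧ ∀ (L : ℕ) [NeZero L], 2 ≤ L → ∀ (m : ℕ), 0 < m →
      ∀ b : Fin (m + 1) → ℝ, b 0 = 0 → Monotone b → ∀ t : ℝ, 0 < t →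
        (∑ j : Fin m, Real.log (weightSqMoment (ambWilsonAction : AmbConfig d L n → ℝ)
            (b j.castSucc) (b j.succ - b j.castSucc))) ≤ t →
          c * Fintype.card (Plaquette d L) * (Real.log (1 + b (Fin.last m))) ^ 2 / t -
              Real.log (1 + b (Fin.last m)) ≤ m := by
  obtain ⟨c, hc, h⟩ := wilson_layers_necessary_anyStart (d := d) hn hd
  refine ⟨c, hc, fun L _ hL m hm b hb0 hb t ht hcost => ?_⟩
  have h' := h L hL m hm b hb0.ge hb t ht hcost
  rwa [hb0, add_zero, div_one] at h'

/-- **HAAR START — PER-STEP WINDOW LAW**: with the same `c`, if every step of an exact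
reweighting / annealing ladder from the Haar measure to coupling `β = b_m` has `log E[w_j²] ≤ t₀`
then **`log(1+β) ≤ m·(t₀/(c·#plaq) + √(t₀/(c·#plaq)))`** — at least `½·√(c·#plaq/t₀)·log(1+β)`
steps when `t₀ ≤ c·#plaq`: the `√VOLUME` window-count law from the Haar prior, in every volume.
[ours] -/
theorem wilson_logRatio_le_of_stepCost_haarStart (hn : 2 ≤ n) (hd : 2 ≤ d) :
    ∃ c : ℝ, 0 < c ∧ ∀ (L : ℕ) [NeZero L], 2 ≤ L →
      ∀ (m : ℕ) (b : Fin (m + 1) → ℝ),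
      b 0 = 0 → Monotone b → ∀ t₀ : ℝ, 0 ≤ t₀ →
        (∀ j : Fin m, Real.log (weightSqMoment (ambWilsonAction : AmbConfig d L n → ℝ)
            (b j.castSucc) (b j.succ - b j.castSucc)) ≤ t₀) →
          Real.log (1 + b (Fin.last m)) ≤
            m * (t₀ / (c * Fintype.card (Plaquette d L)) +
              Real.sqrt (t₀ / (c * Fintype.card (Plaquette d L)))) := by
  obtain ⟨c, hc, h⟩ := wilson_logRatio_le_of_stepCost_anyStart (d := d) hn hd
  refine ⟨c, hc, fun L _ hL m b hb0 hb t₀ ht hstep => ?_⟩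
  have h' := h L hL m b hb0.ge hb t₀ ht hstep
  rwa [hb0, add_zero, div_one] at h'

end WilsonLaws

end Summit.Ventures.LatticeQCDFlow.Theory2.HaarStart

end
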